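import Mathlib.MeasureTheory.Integral.IntegralEqImproper
import Mathlib.Analysis.Calculus.Deriv.MeanValue
import Mathlib.Analysis.SpecialFunctions.Pow.Real
import HarnessLib

/-!
# Square-integrable solutions of constant-coefficient second-order linear ODEs on `ℝ` vanish

Topic `Literature/Analysis/ODE`. Proof file (everything proved; no definitions, no named facts).
Written for the uniqueness of finite-energy very weak solutions of Elgindi's polar elliptic
problem (`Literature/Analysis/FluidPDE/Elgindi*`: after an angular polynomial-mode expansion and
the substitution `R = e^s`, each radial mode is an `L²(ℝ)` solution of a constant-coefficient
equation), but stated in general: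

* `sq_integral_deriv_le` — the elementary interpolation inequality on an interval of length `L`,
  `∫_I v′² ≤ (216/L²)∫_I v² + 2L²∫_I v″²`;
* `integrable_sq_deriv_of_ode` — an `L²(ℝ)` classical solution of `a v″ + b v′ + c v = 0`
  (`a ≠ 0`) has `v′ ∈ L²(ℝ)` (hence `v″ ∈ L²(ℝ)`);
* `eq_zero_of_ode_of_integrable_sq` — **such a solution vanishes identically** (energy
  identities `∫v′v = ∫v″v′ = 0`, `∫v″v = −∫v′²`, and, in the oscillatory case, conservation of
  `v′² + ω²v²`).

## References

* E. A. Coddington, N. Levinson, *Theory of Ordinary Differential Equations*, McGraw–Hill 1955,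
  Ch. 3 §1 (equations with constant coefficients). [folklore]
-/

noncomputable section

open MeasureTheory Set Real Filter Function
open _root_.Topology

namespace Literature.Analysis.ODE

/-! ### Elementary inequalities on an interval -/

/-- A continuous function takes a value whose square is at most the mean of its square. [folklore] -/
theorem exists_sq_mul_le_integral {v : ℝ → ℝ} (hv : Continuous v) {p q : ℝ} (hpq : p < q) :
    ∃ ξ ∈ Icc p q, v ξ ^ 2 * (q - p) ≤ ∫ x in p..q, v x ^ 2 := by
  by_contra h
  simp only [not_exists, not_and, not_le] at h
  have hlt : ∀ x ∈ Icc p q, (∫ x in p..q, v x ^ 2) / (q - p) < v x ^ 2 := fun x hx => by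
    rw [div_lt_iff₀ (by linarith)]; exact h x hx
  have hcont : ContinuousOn (fun x => v x ^ 2) (Icc p q) := (hv.pow 2).continuousOn
  have key : ∫ x in p..q, (∫ x in p..q, v x ^ 2) / (q - p) < ∫ x in p..q, v x ^ 2 :=
    intervalIntegral.integral_lt_integral_of_continuousOn_of_le_of_exists_lt hpq continuousOn_const hcont
      (fun x hx => (hlt x (Ioc_subset_Icc_self hx)).le) ⟨p, left_mem_Icc.2 hpq.le, hlt p (left_mem_Icc.2 hpq.le)⟩
  rw [intervalIntegral.integral_const, smul_eq_mul, mul_div_cancel₀ _ (by linarith : q - p ≠ 0)] at key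
  exact lt_irrefl _ key

/-- **Cauchy–Schwarz on an interval**: `(∫_a^b f)² ≤ (b − a)∫_a^b f²` for continuous `f`, `a ≤ b`
(from `∫ (f − mean)² ≥ 0`). [folklore] -/
theorem sq_intervalIntegral_le {f : ℝ → ℝ} (hf : Continuous f) {a b : ℝ} (hab : a ≤ b) :
    (∫ x in a..b, f x) ^ 2 ≤ (b - a) * ∫ x in a..b, f x ^ 2 := by
  rcases hab.lt_or_eq with hlt | heq
  · set m : ℝ := (∫ x in a..b, f x) / (b - a) with hm
    have h0 : 0 ≤ ∫ x in a..b, (f x - m) ^ 2 := intervalIntegral.integral_nonneg hlt.le fun x _ => sq_nonneg _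
    have i1 : IntervalIntegrable (fun x => f x ^ 2) volume a b := (by fun_prop : Continuous fun x => f x ^ 2).intervalIntegrable _ _
    have i2 : IntervalIntegrable (fun x => 2 * m * f x) volume a b := (hf.const_mul _).intervalIntegrable _ _
    have i3 : IntervalIntegrable (fun _ => m ^ 2) volume a b := intervalIntegrable_const
    have e : ∫ x in a..b, (f x - m) ^ 2 = (∫ x in a..b, f x ^ 2) - 2 * m * (∫ x in a..b, f x) + m ^ 2 * (b - a) := by
      have : (fun x => (f x - m) ^ 2) = fun x => f x ^ 2 - 2 * m * f x + m ^ 2 := by funext x; ring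
      rw [this, intervalIntegral.integral_add (i1.sub i2) i3, intervalIntegral.integral_sub i1 i2, intervalIntegral.integral_const_mul,
        intervalIntegral.integral_const, smul_eq_mul]
      ring
    rw [e] at h0
    have hba : 0 < b - a := by linarith
    have hm' : m * (b - a) = ∫ x in a..b, f x := by rw [hm]; field_simp
    nlinarith [hm', h0, hba]
  · subst heq; simp

/-- **Interpolation on an interval**: for `v ∈ C²` and `p < q`, `L = q − p`,
`∫_p^q v′² ≤ (216/L²)∫_p^q v² + 2L²∫_p^q v″²`. [folklore] -/
theorem sq_integral_deriv_le {v : ℝ → ℝ} (hv : ContDiff ℝ 2 v) {p q : ℝ} (hpq : p < q) :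
    ∫ x in p..q, deriv v x ^ 2 ≤ 216 / (q - p) ^ 2 * (∫ x in p..q, v x ^ 2) + 2 * (q - p) ^ 2 * ∫ x in p..q, deriv (deriv v) x ^ 2 := by
  set L := q - p with hL
  have hL0 : 0 < L := by linarith
  have hv1 : ContDiff ℝ 1 (deriv v) := by have := hv.iterate_deriv' 1 1; simpa using this
  have hdv : Differentiable ℝ v := hv.differentiable (by simp)
  have hdv' : Differentiable ℝ (deriv v) := hv1.differentiable (by simp)
  have cv : Continuous v := hv.continuous
  have cv' : Continuous (deriv v) := hv1.continuous
  have cv'' : Continuous (deriv (deriv v)) := hv1.continuous_deriv le_rfl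
  -- two points with small values of `v`
  have h13 : p < p + L / 3 := by linarith
  have h23 : q - L / 3 < q := by linarith
  obtain ⟨ξ₁, hξ₁, hv₁⟩ := exists_sq_mul_le_integral cv h13
  obtain ⟨ξ₂, hξ₂, hv₂⟩ := exists_sq_mul_le_integral cv h23
  have hξ : ξ₁ < ξ₂ := by linarith [hξ₁.2, hξ₂.1]
  have hξd : L / 3 ≤ ξ₂ - ξ₁ := by linarith [hξ₁.2, hξ₂.1]
  have nn : ∀ a b, a ≤ b → 0 ≤ ∫ x in a..b, v x ^ 2 := fun a b hab =>
    intervalIntegral.integral_nonneg hab fun x _ => sq_nonneg _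
  have iv2 : ∀ c d, IntervalIntegrable (fun x => v x ^ 2) volume c d := fun c d =>
    (by fun_prop : Continuous fun x => v x ^ 2).intervalIntegrable _ _
  have mono1 : ∫ x in p..(p + L / 3), v x ^ 2 ≤ ∫ x in p..q, v x ^ 2 := by
    have s := intervalIntegral.integral_add_adjacent_intervals (iv2 p (p + L / 3)) (iv2 (p + L / 3) q)
    linarith [nn (p + L / 3) q (by linarith)]
  have mono2 : ∫ x in (q - L / 3)..q, v x ^ 2 ≤ ∫ x in p..q, v x ^ 2 := by
    have s := intervalIntegral.integral_add_adjacent_intervals (iv2 p (q - L / 3)) (iv2 (q - L / 3) q)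
    linarith [nn p (q - L / 3) (by linarith)]
  set A := ∫ x in p..q, v x ^ 2 with hA
  set B := ∫ x in p..q, deriv (deriv v) x ^ 2 with hB
  have hA0 : 0 ≤ A := nn p q hpq.le
  have hB0 : 0 ≤ B := intervalIntegral.integral_nonneg hpq.le fun x _ => sq_nonneg _
  have e1 : v ξ₁ ^ 2 * L ≤ 3 * A := by
    have h := hv₁; rw [show p + L / 3 - p = L / 3 by ring] at h; nlinarith [h.trans mono1]
  have e2 : v ξ₂ ^ 2 * L ≤ 3 * A := by
    have h := hv₂; rw [show q - (q - L / 3) = L / 3 by ring] at h; nlinarith [h.trans mono2]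
  -- mean value theorem: a point where `v'` is small
  obtain ⟨ζ, hζ, hζeq⟩ := exists_deriv_eq_slope v hξ cv.continuousOn hdv.differentiableOn
  have eζ : deriv v ζ ^ 2 * L ^ 3 ≤ 108 * A := by
    have hpos : 0 < ξ₂ - ξ₁ := by linarith
    have hmul : deriv v ζ * (ξ₂ - ξ₁) = v ξ₂ - v ξ₁ := by rw [hζeq]; field_simp
    have hsq : (deriv v ζ * (ξ₂ - ξ₁)) ^ 2 ≤ 2 * (v ξ₁ ^ 2 + v ξ₂ ^ 2) := by
      rw [hmul]; nlinarith [sq_nonneg (v ξ₂ + v ξ₁)]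
    -- `v'(ζ)²(L/3)² ≤ v'(ζ)²(ξ₂−ξ₁)² ≤ 2(v₁² + v₂²) ≤ 12A/L`
    have h1 : deriv v ζ ^ 2 * (L / 3) ^ 2 ≤ deriv v ζ ^ 2 * (ξ₂ - ξ₁) ^ 2 :=
      mul_le_mul_of_nonneg_left (pow_le_pow_left₀ (by linarith) hξd 2) (sq_nonneg _)
    have h2 : deriv v ζ ^ 2 * (ξ₂ - ξ₁) ^ 2 ≤ 2 * (v ξ₁ ^ 2 + v ξ₂ ^ 2) := by rw [← mul_pow]; exact hsq
    have h3 : 2 * (v ξ₁ ^ 2 + v ξ₂ ^ 2) * L ≤ 12 * A := by nlinarith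
    nlinarith [h1, h2, h3, sq_nonneg (deriv v ζ), hL0]
  -- `v'(x) = v'(ζ) + ∫_ζ^x v''`, hence `v'(x)² ≤ 2v'(ζ)² + 2L·B` on `[p, q]`
  have hζI : ζ ∈ Icc p q := ⟨by linarith [hζ.1, hξ₁.1], by linarith [hζ.2, hξ₂.2]⟩
  have subB : ∀ a b, p ≤ a → a ≤ b → b ≤ q → ∫ x in a..b, deriv (deriv v) x ^ 2 ≤ B := by
    intro a b hpa hab hbq
    have iab : ∀ c d, IntervalIntegrable (fun x => deriv (deriv v) x ^ 2) volume c d := fun c d =>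
      (by fun_prop : Continuous fun x => deriv (deriv v) x ^ 2).intervalIntegrable _ _
    have nnB : ∀ c d, c ≤ d → 0 ≤ ∫ x in c..d, deriv (deriv v) x ^ 2 := fun c d hcd =>
      intervalIntegral.integral_nonneg hcd fun x _ => sq_nonneg _
    have s1 := intervalIntegral.integral_add_adjacent_intervals (iab p a) (iab a q)
    have s2 := intervalIntegral.integral_add_adjacent_intervals (iab a b) (iab b q)
    rw [hB]
    linarith [nnB p a hpa, nnB b q hbq]
  have hpt : ∀ x ∈ Icc p q, deriv v x ^ 2 ≤ 2 * deriv v ζ ^ 2 + 2 * (L * B) := by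
    intro x hx
    have hcs : (deriv v x - deriv v ζ) ^ 2 ≤ L * B := by
      rcases le_total ζ x with hle | hle
      · have hftc : deriv v x - deriv v ζ = ∫ t in ζ..x, deriv (deriv v) t := by
          rw [intervalIntegral.integral_deriv_eq_sub (fun t _ => hdv' t) (cv''.intervalIntegrable _ _)]
        rw [hftc]
        refine (sq_intervalIntegral_le cv'' hle).trans ?_
        have h1 : x - ζ ≤ L := by linarith [hx.2, hζI.1]
        have h2 := subB ζ x hζI.1 hle hx.2
        have h3 : 0 ≤ ∫ t in ζ..x, deriv (deriv v) t ^ 2 := intervalIntegral.integral_nonneg hle fun t _ => sq_nonneg _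
        calc (x - ζ) * ∫ t in ζ..x, deriv (deriv v) t ^ 2 ≤ L * ∫ t in ζ..x, deriv (deriv v) t ^ 2 :=
              mul_le_mul_of_nonneg_right h1 h3
          _ ≤ L * B := mul_le_mul_of_nonneg_left h2 hL0.le
      · have hftc : deriv v ζ - deriv v x = ∫ t in x..ζ, deriv (deriv v) t := by
          rw [intervalIntegral.integral_deriv_eq_sub (fun t _ => hdv' t) (cv''.intervalIntegrable _ _)]
        rw [show (deriv v x - deriv v ζ) ^ 2 = (deriv v ζ - deriv v x) ^ 2 by ring, hftc]
        refine (sq_intervalIntegral_le cv'' hle).trans ?_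
        have h1 : ζ - x ≤ L := by linarith [hx.1, hζI.2]
        have h2 := subB x ζ hx.1 hle hζI.2
        have h3 : 0 ≤ ∫ t in x..ζ, deriv (deriv v) t ^ 2 := intervalIntegral.integral_nonneg hle fun t _ => sq_nonneg _
        calc (ζ - x) * ∫ t in x..ζ, deriv (deriv v) t ^ 2 ≤ L * ∫ t in x..ζ, deriv (deriv v) t ^ 2 :=
              mul_le_mul_of_nonneg_right h1 h3
          _ ≤ L * B := mul_le_mul_of_nonneg_left h2 hL0.le
    nlinarith [hcs, sq_nonneg (deriv v x - 2 * deriv v ζ), sq_nonneg (deriv v x + deriv v ζ - (deriv v x - deriv v ζ))]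
  -- integrate the pointwise bound over `[p, q]`
  have hint : ∫ x in p..q, deriv v x ^ 2 ≤ ∫ x in p..q, (2 * deriv v ζ ^ 2 + 2 * (L * B)) :=
    intervalIntegral.integral_mono_on hpq.le ((by fun_prop : Continuous fun x => deriv v x ^ 2).intervalIntegrable _ _) intervalIntegrable_const fun x hx => hpt x hx
  rw [intervalIntegral.integral_const, smul_eq_mul] at hint
  -- `(q − p)(2v'(ζ)² + 2LB) = 2L v'(ζ)² + 2L²B ≤ 216A/L² + 2L²B`
  have hfin : L * (2 * deriv v ζ ^ 2) ≤ 216 / L ^ 2 * A := by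
    rw [div_mul_eq_mul_div, le_div_iff₀ (by positivity)]
    nlinarith [eζ, hL0]
  have : (q - p) * (2 * deriv v ζ ^ 2 + 2 * (L * B)) = L * (2 * deriv v ζ ^ 2) + 2 * L ^ 2 * B := by rw [← hL]; ring
  rw [this] at hint
  linarith

/-! ### Square-integrable functions with square-integrable derivative vanish at infinity -/

/-- `|uv| ≤ (u² + v²)/2`: products of square-integrable functions are integrable. [folklore] -/
theorem integrable_mul_of_sq {u w : ℝ → ℝ} (hu : Continuous u) (hw : Continuous w)
    (hu2 : Integrable fun x => u x ^ 2) (hw2 : Integrable fun x => w x ^ 2) : Integrable fun x => u x * w x := by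
  refine Integrable.mono' (show Integrable (fun x => (u x ^ 2 + w x ^ 2) / 2) from (hu2.add hw2).div_const 2)
    (hu.mul hw).aestronglyMeasurable (ae_of_all _ fun x => ?_)
  rw [Real.norm_eq_abs, abs_mul]
  nlinarith [sq_nonneg (|u x| - |w x|), sq_abs (u x), sq_abs (w x)]

/-- A `C¹` function with `v, v′ ∈ L²(ℝ)` tends to `0` at `+∞`. [folklore] -/
theorem tendsto_zero_atTop_of_sq_integrable {v : ℝ → ℝ} (hv : ContDiff ℝ 1 v)
    (h2 : Integrable fun x => v x ^ 2) (h2' : Integrable fun x => deriv v x ^ 2) : Tendsto v atTop (𝓝 0) := by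
  have hd : Differentiable ℝ v := hv.differentiable (by simp)
  have cv : Continuous v := hv.continuous
  have cv' : Continuous (deriv v) := hv.continuous_deriv le_rfl
  have hprod : Integrable fun x => 2 * (v x * deriv v x) := (integrable_mul_of_sq cv cv' h2 h2').const_mul 2
  have hsq : Tendsto (fun x => v x ^ 2) atTop (𝓝 0) := by
    refine tendsto_zero_of_hasDerivAt_of_integrableOn_Ioi (a := 0) (fun x _ => ?_) hprod.integrableOn h2.integrableOn
    have := (hd x).hasDerivAt.pow 2
    exact this.congr_deriv (by ring)
  have habs : Tendsto (fun x => |v x|) atTop (𝓝 0) := by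
    have h := (Real.continuous_sqrt.tendsto 0).comp hsq
    rw [Real.sqrt_zero] at h
    refine h.congr fun x => ?_
    show Real.sqrt (v x ^ 2) = |v x|
    exact Real.sqrt_sq_eq_abs _
  exact (tendsto_zero_iff_abs_tendsto_zero _).2 habs

/-- A `C¹` function with `v, v′ ∈ L²(ℝ)` tends to `0` at `−∞`. [folklore] -/
theorem tendsto_zero_atBot_of_sq_integrable {v : ℝ → ℝ} (hv : ContDiff ℝ 1 v)
    (h2 : Integrable fun x => v x ^ 2) (h2' : Integrable fun x => deriv v x ^ 2) : Tendsto v atBot (𝓝 0) := by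
  have hd : Differentiable ℝ v := hv.differentiable (by simp)
  have cv : Continuous v := hv.continuous
  have cv' : Continuous (deriv v) := hv.continuous_deriv le_rfl
  have hprod : Integrable fun x => 2 * (v x * deriv v x) := (integrable_mul_of_sq cv cv' h2 h2').const_mul 2
  have hsq : Tendsto (fun x => v x ^ 2) atBot (𝓝 0) := by
    refine tendsto_zero_of_hasDerivAt_of_integrableOn_Iic (a := 0) (fun x _ => ?_) hprod.integrableOn h2.integrableOn
    have := (hd x).hasDerivAt.pow 2
    exact this.congr_deriv (by ring)
  have habs : Tendsto (fun x => |v x|) atBot (𝓝 0) := by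
    have h := (Real.continuous_sqrt.tendsto 0).comp hsq
    rw [Real.sqrt_zero] at h
    refine h.congr fun x => ?_
    show Real.sqrt (v x ^ 2) = |v x|
    exact Real.sqrt_sq_eq_abs _
  exact (tendsto_zero_iff_abs_tendsto_zero _).2 habs

/-! ### `L²` solutions of `a v″ + b v′ + c v = 0` -/

section ode

variable {v : ℝ → ℝ} {a b c : ℝ} (hv : ContDiff ℝ 2 v) (ha : a ≠ 0)
  (hode : ∀ x, a * deriv (deriv v) x + b * deriv v x + c * v x = 0) (h2 : Integrable fun x => v x ^ 2)
include hv ha hode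

/-- The pointwise bound `v″² ≤ 2(b/a)²v′² + 2(c/a)²v²`. [folklore] -/
theorem sq_deriv2_le (x : ℝ) : deriv (deriv v) x ^ 2 ≤ 2 * (b / a) ^ 2 * deriv v x ^ 2 + 2 * (c / a) ^ 2 * v x ^ 2 := by
  have _hv := hv
  have e : deriv (deriv v) x = -(b / a) * deriv v x - (c / a) * v x := by
    have := hode x; field_simp; linarith
  rw [e]; nlinarith [sq_nonneg ((b / a) * deriv v x - (c / a) * v x)]

include h2 in
/-- **`v′ ∈ L²`** for an `L²(ℝ)` solution. [folklore] -/
theorem integrable_sq_deriv_of_ode : Integrable fun x => deriv v x ^ 2 := by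
  have hv1 : ContDiff ℝ 1 (deriv v) := by have := hv.iterate_deriv' 1 1; simpa using this
  have cv : Continuous v := hv.continuous
  have cv' : Continuous (deriv v) := hv1.continuous
  have cv'' : Continuous (deriv (deriv v)) := hv1.continuous_deriv le_rfl
  set κ : ℝ := (b / a) ^ 2 with hκ
  set μ : ℝ := (c / a) ^ 2 with hμ
  have hκ0 : 0 ≤ κ := sq_nonneg _
  have hμ0 : 0 ≤ μ := sq_nonneg _
  -- choose `L` with `4L²κ ≤ 1/2`
  obtain ⟨L, hL0, hL⟩ : ∃ L : ℝ, 0 < L ∧ 4 * L ^ 2 * κ ≤ 1 / 2 := by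
    refine ⟨1 / (4 * Real.sqrt (κ + 1)), by positivity, ?_⟩
    have hs : 0 < Real.sqrt (κ + 1) := Real.sqrt_pos.2 (by linarith)
    have hs2 : Real.sqrt (κ + 1) ^ 2 = κ + 1 := Real.sq_sqrt (by linarith)
    rw [div_pow, one_pow, mul_pow, show (4:ℝ) ^ 2 = 16 by norm_num, hs2]
    rw [show 4 * (1 / (16 * (κ + 1))) * κ = κ / (4 * (κ + 1)) by field_simp; ring]
    rw [div_le_iff₀ (by positivity)]; nlinarith
  set K : ℝ := 2 * (216 / L ^ 2 + 4 * L ^ 2 * μ) with hK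
  have hK0 : 0 ≤ K := by positivity
  -- the bound on every interval of length `L`
  have hI : ∀ p : ℝ, ∫ x in p..(p + L), deriv v x ^ 2 ≤ K * ∫ x in p..(p + L), v x ^ 2 := by
    intro p
    have h1 := sq_integral_deriv_le hv (by linarith : p < p + L)
    rw [show p + L - p = L by ring] at h1
    have ib : ∫ x in p..(p + L), deriv (deriv v) x ^ 2 ≤ ∫ x in p..(p + L), (2 * κ * deriv v x ^ 2 + 2 * μ * v x ^ 2) :=
      intervalIntegral.integral_mono_on (by linarith) ((by fun_prop : Continuous fun x => deriv (deriv v) x ^ 2).intervalIntegrable _ _)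
        ((by fun_prop : Continuous fun x => 2 * κ * deriv v x ^ 2 + 2 * μ * v x ^ 2).intervalIntegrable _ _)
        fun x _ => sq_deriv2_le hv ha hode x
    have isplit : ∫ x in p..(p + L), (2 * κ * deriv v x ^ 2 + 2 * μ * v x ^ 2) =
        2 * κ * (∫ x in p..(p + L), deriv v x ^ 2) + 2 * μ * ∫ x in p..(p + L), v x ^ 2 := by
      rw [intervalIntegral.integral_add ((by fun_prop : Continuous fun x => 2 * κ * deriv v x ^ 2).intervalIntegrable _ _)
        ((by fun_prop : Continuous fun x => 2 * μ * v x ^ 2).intervalIntegrable _ _), intervalIntegral.integral_const_mul,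
        intervalIntegral.integral_const_mul]
    rw [isplit] at ib
    have nA : 0 ≤ ∫ x in p..(p + L), v x ^ 2 := intervalIntegral.integral_nonneg (by linarith) fun x _ => sq_nonneg _
    have nD : 0 ≤ ∫ x in p..(p + L), deriv v x ^ 2 := intervalIntegral.integral_nonneg (by linarith) fun x _ => sq_nonneg _
    set D := ∫ x in p..(p + L), deriv v x ^ 2
    set A := ∫ x in p..(p + L), v x ^ 2
    -- `D ≤ (216/L²)A + 2L²(2κD + 2μA)` and `4L²κ ≤ 1/2`
    have h3 : 2 * L ^ 2 * (2 * κ * D) ≤ (1 / 2) * D := by nlinarith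
    have : D ≤ 216 / L ^ 2 * A + (1 / 2) * D + 4 * L ^ 2 * μ * A := by nlinarith [h1, ib, h3]
    rw [hK]; nlinarith
  -- the bound on `[-nL, nL]` by induction
  have iv' : ∀ p q, IntervalIntegrable (fun x => deriv v x ^ 2) volume p q := fun p q =>
    (by fun_prop : Continuous fun x => deriv v x ^ 2).intervalIntegrable _ _
  have iv : ∀ p q, IntervalIntegrable (fun x => v x ^ 2) volume p q := fun p q =>
    (by fun_prop : Continuous fun x => v x ^ 2).intervalIntegrable _ _
  have hN : ∀ n : ℕ, ∫ x in (-(n * L))..(n * L), deriv v x ^ 2 ≤ K * ∫ x in (-(n * L))..(n * L), v x ^ 2 := by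
    intro n
    induction n with
    | zero => simp
    | succ n ih =>
      have hm : ((n + 1 : ℕ) : ℝ) * L = n * L + L := by push_cast; ring
      rw [hm]
      set m : ℝ := n * L with hmdef
      have e1 := intervalIntegral.integral_add_adjacent_intervals (iv' (-(m + L)) (-m)) (iv' (-m) (m + L))
      have e2 := intervalIntegral.integral_add_adjacent_intervals (iv' (-m) m) (iv' m (m + L))
      have f1 := intervalIntegral.integral_add_adjacent_intervals (iv (-(m + L)) (-m)) (iv (-m) (m + L))
      have f2 := intervalIntegral.integral_add_adjacent_intervals (iv (-m) m) (iv m (m + L))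
      have g1 := hI (-(m + L))
      have g2 := hI m
      rw [show -(m + L) + L = -m by ring] at g1
      have kf : K * (∫ x in (-(m + L))..(m + L), v x ^ 2) =
          K * (∫ x in (-(m + L))..(-m), v x ^ 2) + K * (∫ x in (-m)..m, v x ^ 2) + K * ∫ x in m..(m + L), v x ^ 2 := by
        rw [← f1, ← f2]; ring
      linarith
  -- conclude integrability
  have htoInf : Tendsto (fun n : ℕ => (n : ℝ) * L) atTop atTop := tendsto_natCast_atTop_atTop.atTop_mul_const hL0
  refine integrable_of_intervalIntegral_norm_bounded (K * ∫ x, v x ^ 2) (fun n => ((by fun_prop : Continuous fun x => deriv v x ^ 2).integrableOn_Icc).mono_set Ioc_subset_Icc_self)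
    (tendsto_neg_atTop_atBot.comp htoInf) htoInf (Eventually.of_forall fun n => ?_)
  have e : ∫ x in (-(n * L))..(n * L), ‖deriv v x ^ 2‖ = ∫ x in (-(n * L))..(n * L), deriv v x ^ 2 :=
    intervalIntegral.integral_congr fun x _ => by rw [Real.norm_eq_abs, abs_of_nonneg (sq_nonneg (deriv v x))]
  show ∫ x in (-((n : ℝ) * L))..((n : ℝ) * L), ‖deriv v x ^ 2‖ ≤ K * ∫ x, v x ^ 2
  rw [e]
  refine (hN n).trans (mul_le_mul_of_nonneg_left ?_ hK0)
  rw [intervalIntegral.integral_of_le (by nlinarith [hL0, (Nat.cast_nonneg n : (0:ℝ) ≤ n)])]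
  exact setIntegral_le_integral h2 (ae_of_all _ fun x => sq_nonneg _)

include h2 in
/-- **An `L²(ℝ)` solution of `a v″ + b v′ + c v = 0` (`a ≠ 0`) vanishes identically.** [folklore] -/
theorem eq_zero_of_ode_of_integrable_sq : ∀ x, v x = 0 := by
  have hv1 : ContDiff ℝ 1 (deriv v) := by have := hv.iterate_deriv' 1 1; simpa using this
  have hd : Differentiable ℝ v := hv.differentiable (by simp)
  have hd' : Differentiable ℝ (deriv v) := hv1.differentiable (by simp)
  have cv : Continuous v := hv.continuous
  have cv' : Continuous (deriv v) := hv1.continuous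
  have cv'' : Continuous (deriv (deriv v)) := hv1.continuous_deriv le_rfl
  have h2' : Integrable fun x => deriv v x ^ 2 := integrable_sq_deriv_of_ode hv ha hode h2
  have h2'' : Integrable fun x => deriv (deriv v) x ^ 2 :=
    Integrable.mono' (((h2'.const_mul (2 * (b / a) ^ 2)).add (h2.const_mul (2 * (c / a) ^ 2))))
      (cv''.pow 2).aestronglyMeasurable (ae_of_all _ fun x => by
        rw [Real.norm_eq_abs, abs_of_nonneg (sq_nonneg _)]; exact sq_deriv2_le hv ha hode x)
  -- products and limits
  have ivv' : Integrable fun x => v x * deriv v x := integrable_mul_of_sq cv cv' h2 h2'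
  have ivv'' : Integrable fun x => v x * deriv (deriv v) x := integrable_mul_of_sq cv cv'' h2 h2''
  have iv'v'' : Integrable fun x => deriv v x * deriv (deriv v) x := integrable_mul_of_sq cv' cv'' h2' h2''
  have lv : Tendsto v atTop (𝓝 0) := tendsto_zero_atTop_of_sq_integrable (hv.of_le (by norm_num)) h2 h2'
  have lvb : Tendsto v atBot (𝓝 0) := tendsto_zero_atBot_of_sq_integrable (hv.of_le (by norm_num)) h2 h2'
  have lv' : Tendsto (deriv v) atTop (𝓝 0) := tendsto_zero_atTop_of_sq_integrable hv1 h2' h2''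
  have lv'b : Tendsto (deriv v) atBot (𝓝 0) := tendsto_zero_atBot_of_sq_integrable hv1 h2' h2''
  -- the three integral identities
  have I1 : ∫ x, v x * deriv v x = 0 := by
    have h := integral_of_hasDerivAt_of_tendsto (f := fun x => v x ^ 2 / 2) (f' := fun x => v x * deriv v x)
      (fun x => by have := ((hd x).hasDerivAt.pow 2).div_const 2; exact this.congr_deriv (by ring)) ivv'
      (by simpa using (lvb.pow 2).div_const 2) (by simpa using (lv.pow 2).div_const 2)
    simpa using h
  have I2 : ∫ x, (deriv v x ^ 2 + v x * deriv (deriv v) x) = 0 := by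
    have h := integral_of_hasDerivAt_of_tendsto (f := fun x => v x * deriv v x) (f' := fun x => deriv v x ^ 2 + v x * deriv (deriv v) x)
      (fun x => by have := (hd x).hasDerivAt.mul (hd' x).hasDerivAt; exact this.congr_deriv (by ring)) (h2'.add ivv'')
      (by simpa using lvb.mul lv'b) (by simpa using lv.mul lv')
    simpa using h
  have I3 : ∫ x, deriv v x * deriv (deriv v) x = 0 := by
    have h := integral_of_hasDerivAt_of_tendsto (f := fun x => deriv v x ^ 2 / 2) (f' := fun x => deriv v x * deriv (deriv v) x)
      (fun x => by have := ((hd' x).hasDerivAt.pow 2).div_const 2; exact this.congr_deriv (by ring)) iv'v''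
      (by simpa using (lv'b.pow 2).div_const 2) (by simpa using (lv'.pow 2).div_const 2)
    simpa using h
  rw [integral_add h2' ivv''] at I2
  set P := ∫ x, v x ^ 2 with hP
  set Q := ∫ x, deriv v x ^ 2 with hQ
  have hP0 : 0 ≤ P := integral_nonneg fun x => sq_nonneg _
  have hQ0 : 0 ≤ Q := integral_nonneg fun x => sq_nonneg _
  -- (E1) `−aQ + cP = 0`, (E3) `bQ = 0`
  have E1 : -a * Q + c * P = 0 := by
    have h : ∫ x, (a * (v x * deriv (deriv v) x) + b * (v x * deriv v x) + c * v x ^ 2) = 0 := by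
      rw [integral_eq_zero_of_ae (ae_of_all _ fun x => ?_)]
      show a * (v x * deriv (deriv v) x) + b * (v x * deriv v x) + c * v x ^ 2 = 0
      have := hode x
      linear_combination (v x) * this
    have iA : Integrable fun x => a * (v x * deriv (deriv v) x) := ivv''.const_mul a
    have iB : Integrable fun x => b * (v x * deriv v x) := ivv'.const_mul b
    have iC : Integrable fun x => c * v x ^ 2 := h2.const_mul c
    have iAB : Integrable fun x => a * (v x * deriv (deriv v) x) + b * (v x * deriv v x) := iA.add iB
    rw [integral_add iAB iC, integral_add iA iB, integral_const_mul, integral_const_mul, integral_const_mul, I1] at h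
    have hvv : ∫ x, v x * deriv (deriv v) x = -Q := by linarith [I2]
    rw [hvv] at h
    linarith
  have E3 : b * Q = 0 := by
    have h : ∫ x, (a * (deriv v x * deriv (deriv v) x) + b * deriv v x ^ 2 + c * (v x * deriv v x)) = 0 := by
      rw [integral_eq_zero_of_ae (ae_of_all _ fun x => ?_)]
      show a * (deriv v x * deriv (deriv v) x) + b * deriv v x ^ 2 + c * (v x * deriv v x) = 0
      have := hode x
      linear_combination (deriv v x) * this
    have iA : Integrable fun x => a * (deriv v x * deriv (deriv v) x) := iv'v''.const_mul a
    have iB : Integrable fun x => b * deriv v x ^ 2 := h2'.const_mul b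
    have iC : Integrable fun x => c * (v x * deriv v x) := ivv'.const_mul c
    have iAB : Integrable fun x => a * (deriv v x * deriv (deriv v) x) + b * deriv v x ^ 2 := iA.add iB
    rw [integral_add iAB iC, integral_add iA iB, integral_const_mul, integral_const_mul, integral_const_mul, I1, I3] at h
    linarith
  -- zero integral of a continuous nonnegative function forces it to vanish
  have zeroP : P = 0 → ∀ x, v x = 0 := fun h x => by
    have h' : (fun x => v x ^ 2) =ᵐ[volume] 0 := (integral_eq_zero_iff_of_nonneg (fun x => sq_nonneg _) h2).1 h
    have := ((cv.pow 2).ae_eq_iff_eq (μ := volume) continuous_const).1 h'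
    have hx := congrFun this x
    simp only [Pi.pow_apply] at hx
    exact pow_eq_zero_iff two_ne_zero |>.mp hx
  have zeroQ : Q = 0 → ∀ x, v x = 0 := fun h => by
    have h' : (fun x => deriv v x ^ 2) =ᵐ[volume] 0 := (integral_eq_zero_iff_of_nonneg (fun x => sq_nonneg _) h2').1 h
    have hv'0 : ∀ x, deriv v x = 0 := fun x => by
      have := ((cv'.pow 2).ae_eq_iff_eq (μ := volume) continuous_const).1 h'
      have hx := congrFun this x
      simp only [Pi.pow_apply] at hx
      exact pow_eq_zero_iff two_ne_zero |>.mp hx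
    have hconst : ∀ x, v x = v 0 := fun x => is_const_of_deriv_eq_zero hd hv'0 x 0
    have hlim : Tendsto v atTop (𝓝 (v 0)) := tendsto_const_nhds.congr fun x => (hconst x).symm
    have := tendsto_nhds_unique hlim lv
    intro x; rw [hconst x, this]
  by_cases hb : b = 0
  · subst hb
    by_cases hc : c = 0
    · subst hc
      have : Q = 0 := by
        have : a * Q = 0 := by linarith
        rcases mul_eq_zero.1 this with h | h
        · exact absurd h ha
        · exact h
      exact zeroQ this
    · rcases lt_or_gt_of_ne (mul_ne_zero ha hc) with hac | hac
      · -- `a c < 0`: `cP = aQ` forces `P = 0`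
        have : P = 0 := by
          by_contra hPne
          have hPpos : 0 < P := lt_of_le_of_ne hP0 (Ne.symm hPne)
          have h1 : a * c * P = a * a * Q := by linear_combination a * E1
          have h2 : a * c * P < 0 := mul_neg_of_neg_of_pos hac hPpos
          have h3 : 0 ≤ a * a * Q := mul_nonneg (mul_self_nonneg a) hQ0
          linarith
        exact zeroP this
      · -- `a c > 0`: conservation of `v'² + (c/a)v²`
        have hca : 0 < c / a := by
          rcases lt_or_gt_of_ne ha with ha' | ha'
          · have : c < 0 := by nlinarith
            exact div_pos_of_neg_of_neg this ha'
          · have : 0 < c := by nlinarith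
            exact div_pos this ha'
        set w : ℝ → ℝ := fun x => deriv v x ^ 2 + (c / a) * v x ^ 2 with hw
        have hw' : ∀ x, HasDerivAt w 0 x := fun x => by
          have h1 := ((hd' x).hasDerivAt.pow 2).add (((hd x).hasDerivAt.pow 2).const_mul (c / a))
          refine h1.congr_deriv ?_
          have := hode x
          simp only [zero_mul, add_zero] at this
          have e : deriv (deriv v) x = -(c / a) * v x := by field_simp; linarith
          simp only [Nat.cast_ofNat]
          rw [e]; ring
        have hwc : ∀ x, w x = w 0 := fun x => is_const_of_deriv_eq_zero (fun x => (hw' x).differentiableAt) (fun x => (hw' x).deriv) x 0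
        have hwi : Integrable w := h2'.add (h2.const_mul _)
        have hw0 : w 0 = 0 := by
          have : Integrable (fun _ : ℝ => w 0) := hwi.congr (ae_of_all _ fun x => hwc x)
          rcases integrable_const_iff.1 this with h | h
          · exact h
          · exact absurd h (by
              intro hfin
              have := hfin.measure_univ_lt_top
              simp at this)
        intro x
        have hx : w x = 0 := by rw [hwc x, hw0]
        have : (c / a) * v x ^ 2 = 0 := by
          have h1 : 0 ≤ deriv v x ^ 2 := sq_nonneg _
          have h2x : 0 ≤ (c / a) * v x ^ 2 := by positivity
          simp only [hw] at hx
          linarith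
        rcases mul_eq_zero.1 this with h | h
        · exact absurd h hca.ne'
        · exact pow_eq_zero_iff (n := 2) (by norm_num) |>.1 h
  · have : Q = 0 := by
      rcases mul_eq_zero.1 E3 with h | h
      · exact absurd h hb
      · exact h
    exact zeroQ this

end ode

end Literature.Analysis.ODE
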